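import Mathlib.Analysis.SpecialFunctions.Pow.Real
import Mathlib.Analysis.SpecialFunctions.Sqrt
import Literature.MathematicalPhysics.QuantumLattice.FinDimSpectrumSectorGibbsLimit
import Literature.MathematicalPhysics.QuantumLattice.PairCorrelationsProofs

/-!
# Route `BalabanIR`, crux 5 `BirEveryGroundState` (item `stmt-HubbardSuperconductivity-2083`): the variance head-count

The exp-free first lemma of card `exponential-headcount-entropy-vs-tail` (a quantitative
average → every transfer that needs no irreducibility): for a Hermitian `Y`, a subspace
`K ≠ ⊥` with orthogonal projection matrix `P` (`tr P = dim K =: m`) and tracial mean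
`ȳ = re tr (P Y) / m`, EVERY unit vector `ψ ∈ K` satisfies

  `ȳ - √(re tr (P Y Y) - m ȳ²) ≤ re ⟨ψ, Y ψ⟩`                    (`varianceHeadCount`).

Proof (eigenvalue-free): with `D = P Y P - ȳ P` (Hermitian), `re ⟨ψ, Y ψ⟩ - ȳ = re ⟨ψ, D ψ⟩` for
unit `ψ ∈ K`; `|⟨ψ, D ψ⟩| ≤ ‖D ψ‖ ≤ ‖D‖_F = √(re tr (D D))` (Cauchy–Schwarz, Frobenius ≥ operator
norm); `tr (D D) = tr (P Y P Y) - m ȳ²` (`P² = P`, cyclicity, `tr (P Y) = m ȳ`); and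
`tr (P Y Y) - tr (P Y P Y) = tr (Mᴴ M) ≥ 0` for `M = (1 - P) Y P`. So the spread of `⟨Y⟩` over the
unit vectors of `K` (e.g. a ground eigenspace) is controlled by a TRACE (ground-state-average)
quantity, the tracial variance of `Y`, times `√m`.
Tasaki (2020) App. A.2; Bhatia, *Matrix Analysis* (1997) §I.2 (Frobenius vs operator norm).
Everything is folklore; no definition is introduced.
Rev-5 MATERIALISATION RULE of the route: since its 2026-08-16 revision this module imports no
route file (`…Theses.BalabanIR`) and no Theorems module that does (`tr P_K = dim K` is taken from
Literature's `trace_projMatrix_map_eq_finrank`), so that Theses-free CLOSING modules may import it.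
-/

noncomputable section

namespace Summit.HubbardSuperconductivity.HubbardSuperconductivity.Theorems

open Matrix Finset
open Literature.MathematicalPhysics.QuantumLattice
open scoped ComplexOrder

section Frobenius

variable {n : Type*} [Fintype n]

/-- `re ⟨v, v⟩ = Σ_i |v_i|²`. [folklore] -/
theorem re_star_dotProduct_self_eq_sum (v : n → ℂ) :
    (star v ⬝ᵥ v).re = ∑ i, ‖v i‖ ^ 2 := by
  rw [dotProduct, Complex.re_sum]
  refine Finset.sum_congr rfl fun i _ => ?_
  rw [Pi.star_apply, Complex.star_def, Complex.conj_mul']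
  norm_cast

/-- `re tr (Dᴴ D) = Σ_{i,j} |D_{ij}|²` (the squared Frobenius norm). [folklore] -/
theorem re_trace_conjTranspose_mul_self_eq_sum (D : Matrix n n ℂ) :
    (Dᴴ * D).trace.re = ∑ i, ∑ j, ‖D i j‖ ^ 2 := by
  rw [Matrix.trace]
  simp only [Matrix.diag_apply, Matrix.mul_apply, conjTranspose_apply, Complex.re_sum]
  rw [Finset.sum_comm]
  refine Finset.sum_congr rfl fun i _ => Finset.sum_congr rfl fun j _ => ?_
  rw [Complex.star_def, Complex.conj_mul']
  norm_cast

/-- **Frobenius bound**: `‖D ψ‖² ≤ ‖D‖_F² ‖ψ‖²`, i.e.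
`re ⟨D ψ, D ψ⟩ ≤ re tr (Dᴴ D) · re ⟨ψ, ψ⟩` (row-wise Cauchy–Schwarz).
Bhatia, *Matrix Analysis* §I.2. [folklore] -/
theorem re_star_mulVec_dotProduct_mulVec_le (D : Matrix n n ℂ) (ψ : n → ℂ) :
    (star (D *ᵥ ψ) ⬝ᵥ (D *ᵥ ψ)).re ≤ (Dᴴ * D).trace.re * (star ψ ⬝ᵥ ψ).re := by
  rw [re_star_dotProduct_self_eq_sum, re_trace_conjTranspose_mul_self_eq_sum,
    re_star_dotProduct_self_eq_sum, Finset.sum_mul]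
  refine Finset.sum_le_sum fun i _ => ?_
  -- row `i`: `|Σ_j D_ij ψ_j|² ≤ (Σ_j |D_ij| |ψ_j|)² ≤ (Σ_j |D_ij|²) (Σ_j |ψ_j|²)`
  have h1 : ‖(D *ᵥ ψ) i‖ ≤ ∑ j, ‖D i j‖ * ‖ψ j‖ := by
    rw [Matrix.mulVec, dotProduct]
    refine (norm_sum_le _ _).trans (le_of_eq (Finset.sum_congr rfl fun j _ => norm_mul _ _))
  have h0 : 0 ≤ ∑ j, ‖D i j‖ * ‖ψ j‖ := Finset.sum_nonneg fun j _ => by positivity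
  calc ‖(D *ᵥ ψ) i‖ ^ 2 ≤ (∑ j, ‖D i j‖ * ‖ψ j‖) ^ 2 := pow_le_pow_left₀ (norm_nonneg _) h1 2
    _ ≤ (∑ j, ‖D i j‖ ^ 2) * ∑ j, ‖ψ j‖ ^ 2 := Finset.sum_mul_sq_le_sq_mul_sq _ _ _

/-- **`|⟨ψ, D ψ⟩| ≤ ‖D‖_F` for a unit vector**: `|re ⟨ψ, D ψ⟩|² ≤ re tr (Dᴴ D)`.
(Cauchy–Schwarz `|⟨ψ, D ψ⟩|² ≤ ⟨ψ, ψ⟩ ⟨D ψ, D ψ⟩` and the Frobenius bound.) [folklore] -/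
theorem sq_re_star_dotProduct_mulVec_le (D : Matrix n n ℂ) {ψ : n → ℂ} (hψ : star ψ ⬝ᵥ ψ = 1) :
    (star ψ ⬝ᵥ D *ᵥ ψ).re ^ 2 ≤ (Dᴴ * D).trace.re := by
  -- Cauchy–Schwarz in `EuclideanSpace`
  have hCS : ‖star ψ ⬝ᵥ D *ᵥ ψ‖ ≤
      ‖(WithLp.toLp 2 ψ : EuclideanSpace ℂ n)‖ *
        ‖(WithLp.toLp 2 (D *ᵥ ψ) : EuclideanSpace ℂ n)‖ := by
    rw [star_dotProduct_eq_inner]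
    exact norm_inner_le_norm _ _
  have hψ1 : ‖(WithLp.toLp 2 ψ : EuclideanSpace ℂ n)‖ = 1 := by
    have h := norm_toLp_sq_eq_re ψ
    rw [hψ, Complex.one_re] at h
    have h0 : 0 ≤ ‖(WithLp.toLp 2 ψ : EuclideanSpace ℂ n)‖ := norm_nonneg _
    nlinarith [h, h0]
  rw [hψ1, one_mul] at hCS
  have hF := re_star_mulVec_dotProduct_mulVec_le D ψ
  rw [hψ, Complex.one_re, mul_one, ← norm_toLp_sq_eq_re] at hF
  calc (star ψ ⬝ᵥ D *ᵥ ψ).re ^ 2 ≤ ‖star ψ ⬝ᵥ D *ᵥ ψ‖ ^ 2 := by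
        rw [sq_le_sq, abs_norm]
        exact Complex.abs_re_le_norm _
    _ ≤ ‖(WithLp.toLp 2 (D *ᵥ ψ) : EuclideanSpace ℂ n)‖ ^ 2 :=
        pow_le_pow_left₀ (norm_nonneg _) hCS 2
    _ ≤ (Dᴴ * D).trace.re := hF

end Frobenius

section HeadCount

variable {n : Type*} [Fintype n] [DecidableEq n]

/-- `re tr (P Y P Y) ≤ re tr (P Y Y)` for a Hermitian idempotent `P` and Hermitian `Y`: the
difference is `tr (Mᴴ M) ≥ 0` with `M = (1 - P) Y P`. Tasaki (2020) App. A.2. [folklore] -/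
theorem re_trace_proj_mul_mul_proj_mul_le {P Y : Matrix n n ℂ} (hPH : Pᴴ = P) (hPP : P * P = P)
    (hY : Yᴴ = Y) : (P * Y * P * Y).trace.re ≤ (P * Y * Y).trace.re := by
  have hpos : 0 ≤ (((1 - P) * Y * P)ᴴ * ((1 - P) * Y * P)).trace.re :=
    (Complex.nonneg_iff.mp (Matrix.posSemidef_conjTranspose_mul_self _).trace_nonneg).1
  have h1 : (1 - P)ᴴ = 1 - P := by rw [conjTranspose_sub, conjTranspose_one, hPH]
  have h2 : (1 - P) * (1 - P) = 1 - P := by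
    rw [sub_mul, mul_sub, mul_sub, one_mul, one_mul, mul_one, hPP, sub_self, sub_zero]
  -- `Mᴴ M = P Y (1 - P) Y P`
  have hMM : ((1 - P) * Y * P)ᴴ * ((1 - P) * Y * P) = P * Y * Y * P - P * Y * P * Y * P := by
    rw [conjTranspose_mul, conjTranspose_mul, hPH, hY, h1]
    calc P * (Y * (1 - P)) * ((1 - P) * Y * P)
        = P * Y * ((1 - P) * (1 - P)) * Y * P := by simp only [Matrix.mul_assoc]
      _ = P * Y * (1 - P) * Y * P := by rw [h2]
      _ = P * Y * Y * P - P * Y * P * Y * P := by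
          simp only [Matrix.mul_sub, Matrix.sub_mul, Matrix.mul_one]
  -- its trace is `tr (P Y Y) - tr (P Y P Y)`
  have t1 : (P * Y * Y * P).trace = (P * Y * Y).trace := by
    rw [trace_mul_comm, ← Matrix.mul_assoc, ← Matrix.mul_assoc, hPP]
  have t2 : (P * Y * P * Y * P).trace = (P * Y * P * Y).trace := by
    rw [trace_mul_comm, ← Matrix.mul_assoc, ← Matrix.mul_assoc, ← Matrix.mul_assoc, hPP]
  rw [hMM, trace_sub, t1, t2, Complex.sub_re] at hpos
  linarith

/-- **The variance head-count** (card `exponential-headcount-entropy-vs-tail`, first lemma).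
For Hermitian `Y`, a subspace `K ≠ ⊥` with projection matrix `P` (`m := re tr P = dim K`) and
tracial mean `ȳ := re tr (P Y) / m`, EVERY unit vector `ψ ∈ K` satisfies
`ȳ - √(re tr (P Y Y) - m ȳ²) ≤ re ⟨ψ, Y ψ⟩`: the deviation of any vector's expectation below the
average is at most `√m ×` the tracial standard deviation of `Y` on `K`. (With `D = P Y P - ȳ P`:
`re ⟨ψ, Y ψ⟩ - ȳ = re ⟨ψ, D ψ⟩ ≥ -‖D‖_F`, `‖D‖_F² = tr (P Y P Y) - m ȳ² ≤ tr (P Y Y) - m ȳ²`.)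
Tasaki (2020) App. A.2; Bhatia, *Matrix Analysis* §I.2. [folklore] -/
theorem varianceHeadCount (Y : Matrix n n ℂ) (hY : Y.IsHermitian) (K : Submodule ℂ (n → ℂ))
    (hK : K ≠ ⊥) {ψ : n → ℂ} (hψK : ψ ∈ K) (hψ : star ψ ⬝ᵥ ψ = 1) :
    let P : Matrix n n ℂ := projMatrix (K.map
      ((WithLp.linearEquiv 2 ℂ (n → ℂ)).symm : (n → ℂ) →ₗ[ℂ] EuclideanSpace ℂ n))
    let m : ℝ := P.trace.re
    let ybar : ℝ := (P * Y).trace.re / m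
    ybar - Real.sqrt ((P * Y * Y).trace.re - m * ybar ^ 2) ≤ (star ψ ⬝ᵥ Y *ᵥ ψ).re := by
  intro P m ybar
  have hPH : Pᴴ = P := (projMatrix_isHermitian _).eq
  have hPP : P * P = P := projMatrix_mul_self _
  have hPψ : P *ᵥ ψ = ψ := projMatrix_map_mulVec_of_mem K hψK
  -- `m = dim K > 0`, so `re tr (P Y) = m ȳ`
  have hm : m = (Module.finrank ℂ K : ℝ) := by
    show (projMatrix (K.map ((WithLp.linearEquiv 2 ℂ (n → ℂ)).symm :
      (n → ℂ) →ₗ[ℂ] EuclideanSpace ℂ n))).trace.re = _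
    rw [trace_projMatrix_map_eq_finrank, Complex.natCast_re]
  have hmpos : 0 < m := by
    rw [hm, Nat.cast_pos]
    exact Module.finrank_pos_iff.mpr (Submodule.nontrivial_iff_ne_bot.mpr hK)
  have hPY : (P * Y).trace.re = m * ybar := by
    show (P * Y).trace.re = m * ((P * Y).trace.re / m)
    field_simp
  -- the traceless Hermitian compression `D`
  set D : Matrix n n ℂ := P * Y * P - (ybar : ℂ) • P with hD
  have hDH : Dᴴ = D := by
    rw [hD, conjTranspose_sub, conjTranspose_smul, conjTranspose_mul, conjTranspose_mul, hPH,
      hY.eq, Complex.star_def, Complex.conj_ofReal, Matrix.mul_assoc]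
  -- (1) `re ⟨ψ, Y ψ⟩ - ȳ = re ⟨ψ, D ψ⟩`
  have h1 : (star ψ ⬝ᵥ D *ᵥ ψ).re = (star ψ ⬝ᵥ Y *ᵥ ψ).re - ybar := by
    have hadj : ∀ w, star ψ ⬝ᵥ (P *ᵥ w) = star (P *ᵥ ψ) ⬝ᵥ w := fun w => by
      rw [star_mulVec, hPH, ← dotProduct_mulVec]
    have hPYψ : star ψ ⬝ᵥ (P *ᵥ (Y *ᵥ ψ)) = star ψ ⬝ᵥ (Y *ᵥ ψ) := by rw [hadj, hPψ]
    rw [hD, sub_mulVec, smul_mulVec, ← mulVec_mulVec, ← mulVec_mulVec, hPψ, dotProduct_sub,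
      dotProduct_smul, hPYψ, hψ, Complex.sub_re, smul_eq_mul, mul_one, Complex.ofReal_re]
  -- (2) `re tr (D D) = re tr (P Y P Y) - m ȳ²`
  have h2 : (Dᴴ * D).trace.re = (P * Y * P * Y).trace.re - m * ybar ^ 2 := by
    rw [hDH, hD]
    have e1 : P * Y * P * (P * Y * P) = P * Y * P * Y * P := by
      calc P * Y * P * (P * Y * P) = P * Y * (P * P) * Y * P := by simp only [Matrix.mul_assoc]
        _ = P * Y * P * Y * P := by rw [hPP]
    have e2 : P * Y * P * P = P * Y * P := by rw [Matrix.mul_assoc, hPP]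
    have e3 : P * (P * Y * P) = P * Y * P := by rw [← Matrix.mul_assoc, ← Matrix.mul_assoc, hPP]
    have t1 : (P * Y * P * Y * P).trace = (P * Y * P * Y).trace := by
      rw [trace_mul_comm, ← Matrix.mul_assoc, ← Matrix.mul_assoc, ← Matrix.mul_assoc, hPP]
    have t2 : (P * Y * P).trace = (P * Y).trace := by
      rw [trace_mul_comm, ← Matrix.mul_assoc, hPP]
    simp only [Matrix.sub_mul, Matrix.mul_sub, Matrix.smul_mul, Matrix.mul_smul, e1, e2, e3, hPP,
      trace_sub, trace_smul, t1, t2, smul_eq_mul, Complex.sub_re, Complex.re_ofReal_mul]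
    have hPre : P.trace.re = m := rfl
    rw [hPY, hPre]
    ring
  -- (3) combine with `re tr (P Y P Y) ≤ re tr (P Y Y)`
  have h3 : (P * Y * P * Y).trace.re ≤ (P * Y * Y).trace.re :=
    re_trace_proj_mul_mul_proj_mul_le hPH hPP hY.eq
  have hsq : (star ψ ⬝ᵥ D *ᵥ ψ).re ^ 2 ≤ (P * Y * Y).trace.re - m * ybar ^ 2 := by
    have h := sq_re_star_dotProduct_mulVec_le D hψ
    rw [h2] at h
    linarith
  have hroot : -Real.sqrt ((P * Y * Y).trace.re - m * ybar ^ 2) ≤ (star ψ ⬝ᵥ D *ᵥ ψ).re := by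
    rw [neg_le]
    calc -(star ψ ⬝ᵥ D *ᵥ ψ).re ≤ |(star ψ ⬝ᵥ D *ᵥ ψ).re| := neg_le_abs _
      _ = Real.sqrt ((star ψ ⬝ᵥ D *ᵥ ψ).re ^ 2) := (Real.sqrt_sq_eq_abs _).symm
      _ ≤ Real.sqrt ((P * Y * Y).trace.re - m * ybar ^ 2) := Real.sqrt_le_sqrt hsq
  rw [h1] at hroot
  linarith

end HeadCount

end Summit.HubbardSuperconductivity.HubbardSuperconductivity.Theorems
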